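import Summits.KontsevichZagierPeriods.KontsevichZagierPeriods.Theorems.UnfoldedStokesStokesGenerationFibrewiseRungLanden

/-!
# `StokesGeneration` (stmt-KontsevichZagierPeriods-3586) — line `fibrewise_stokes`, stub `stub_paramLandenLeftovers`

Registered rung stub PL4 (rung 25, LANDEN'S IDENTITY WITH A PARAMETER, wave 6) of the line `fibrewise_stokes` of the
crux `StokesGeneration` (route UnfoldedStokes). Rung 25 runs the certificate of rung 18 (Landen's identity
`Li₂(a) + Li₂(−a/(1−a)) + ½ log²(1−a) = 0`, homotopy `a ↦ au` on `[0,1]³`, `x 0 = s`, `x 1 = t`, `x 2 = u`)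
UNIFORMLY in a silent fourth coordinate `v = x 3`: the algebraic constant `a` becomes the value `a(v)` of a
`ℚ`-semialgebraic `C¹` function on an open interval around `[0,1]` with `a(v) < 1`, and everything is multiplied by a
coefficient `γ(v)` of the same kind. THIS STUB is the parametrised twin of `stub_landenLeftovers`: the leftover
`γ(v)·[(R₁ + R₂ + R₃)(s,u) + A(s,t,u) + (R₃(t,u) − R₃(s,u))]` of the three homotopy certificates
(`R₁ = a/(1−aus)`, `R₂ = −a/((1−au)(1−au+aus))`, `R₃(s,u) = (−a/(1−au))·(−au/(1−aus))`,
`A = ½(k(s,u)k_u(t,u) − k_u(s,u)k(t,u))`, `k(s,u) = −au/(1−aus)`, `k_u(s,u) = −a/(1−aus)²`, `a = a(v)`) is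
fibrewise-Stokes decomposable (`FibStokesDecomposable`, `Theorems/UnfoldedStokesDefs.lean`) on `[0,1]⁴` by the SOFT
relators of rung 12 alone:

* `γ(R₁ + R₂ + R₃) = m − m ∘ ρ₀` for `m = γ(v)(a/(1 − a u))/(1 − a u s)` and the reflection `ρ₀ : s ↦ 1 − s`
  (`landenLeft_sub_comp_reflect_of_contDiffOn`);
* `γA = h − h ∘ σ` for `h = ½ γ(v) k(s,u) k_u(t,u)` and the transposition `σ = (0 1)`
  (`landenLeft_sub_comp_perm_of_contDiffOn`);
* `γ(R₃(t,u) − R₃(s,u)) = −(g − g ∘ σ)` for `g = γ(v) R₃(s,u)` (`landenLeft_sub_comp_perm_of_contDiffOn`,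
  `fibStokesDecomposable_neg`).

No element runs along `v`; `γ(v)` and `a(v)` are constant along every fibre direction used. The data `m`, `h`, `g` are
`ℚ`-semialgebraic and `C¹` in all four variables on the open semialgebraic neighbourhood
`U = {v ∈ (−δ′, 1+δ′)} ∩ {0 < 1 − a(v)us} ∩ {0 < 1 − a(v)ut} ∩ {0 < 1 − a(v)u}` of the cube, where `0 < δ′ < δ` is
RATIONAL (so that the slab is `ℚ`-semialgebraic); `a`, `γ` are read along the coordinate `3`
(`isSemialgebraicFunOn_comp_coord`) and composed with the smooth projection `x ↦ x 3` (`ContDiffOn.comp`). The three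
pieces are added (`fibStokesDecomposable_add`) and compared with the displayed leftover pointwise on the cube
(`fibStokesDecomposable_congr_off_null`, empty null set).

References: M. Kontsevich, D. Zagier, *Periods* (2001), §1.2 rules (2), (3); D. Zagier, *The dilogarithm function*
(2007), §I.2; S. Basu, R. Pollack, M.-F. Roy, *Algorithms in Real Algebraic Geometry* (2006), Prop. 3.22;
J. Bochnak, M. Coste, M.-F. Roy, *Real Algebraic Geometry* (1998), §2.2.
-/

noncomputable section

-- `Summit.KontsevichZagierPeriods.KontsevichZagierPeriods.…` is the tree's mandated layout (single-conjunct summit).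
set_option linter.dupNamespace false

namespace Summit.KontsevichZagierPeriods.KontsevichZagierPeriods.Cruxes.StokesGeneration.FibrewiseStokes

open MeasureTheory Set
open Literature.NumberTheory.Transcendental
open Literature.NumberTheory.Transcendental.KZ
open Literature.ModelTheory.ExponentialFields (IsSemialgebraic)

/-- Open coordinate slabs `{x | −q < x i < 1 + q}` with a RATIONAL margin `q` are `ℚ`-semialgebraic (two strict
sign conditions on `ℚ`-semialgebraic functions). [cite: BochnakCosteRoy1998, §2.2] -/
private theorem paramLandenLeft_isSemialgebraic_slab {N : ℕ} (q : ℚ) (i : Fin N) :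
    IsSemialgebraic ℚ {x : Fin N → ℝ | x i ∈ Set.Ioo (-(q : ℝ)) (1 + q)} := by
  have hu : IsSemialgebraic ℚ (Set.univ : Set (Fin N → ℝ)) :=
    Literature.ModelTheory.ExponentialFields.isSemialgebraic_univ
  have hx : IsSemialgebraicFunOn ℚ Set.univ (fun x : Fin N → ℝ => x i) := isSemialgebraicFunOn_apply hu i
  have h1 := ((isSemialgebraicFunOn_const_ratCast hu (-q)).fun_sub hx).isSemialgebraic_sep_neg
  have h2 := (hx.fun_sub (isSemialgebraicFunOn_const_ratCast hu (1 + q))).isSemialgebraic_sep_neg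
  convert h1.inter h2 using 1
  ext x
  simp only [mem_setOf_eq, mem_Ioo, mem_inter_iff, mem_univ, true_and, sub_neg, Rat.cast_neg, Rat.cast_add,
    Rat.cast_one]

/-- **Registered stub `stub_paramLandenLeftovers` (rung 25, PL4): the parametrised Landen leftovers are soft.**
On `[0,1]⁴` (`s = x 0`, `t = x 1`, `u = x 2`, silent `v = x 3`), for `a, γ` `ℚ`-semialgebraic and `C¹` on
`(−δ, 1+δ)` with `a < 1` there, `γ(v)·[(R₁ + R₂ + R₃)(x₀,x₂) + A + (R₃(x₁,x₂) − R₃(x₀,x₂))]` (`a = a(v)`) is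
fibrewise-Stokes decomposable by rung 12 alone: `γ(R₁ + R₂ + R₃) = m − m ∘ ρ₀` for
`m = γ(v)(a/(1 − a x₂))/(1 − a x₂ x₀)` and the reflection `ρ₀ : x₀ ↦ 1 − x₀`, `γA = h − h ∘ σ₀₁` for
`h = ½ γ(v) k(x₀,x₂) k_u(x₁,x₂)` and `γ(R₃(x₁,x₂) − R₃(x₀,x₂)) = −(g − g ∘ σ₀₁)` for `g = γ(v) R₃(x₀,x₂)`; all data
are `C¹` and `ℚ`-semialgebraic in the four variables on the open semialgebraic neighbourhood
`{v ∈ (−δ′, 1+δ′)} ∩ {0 < 1 − a x₂ x₀} ∩ {0 < 1 − a x₂ x₁} ∩ {0 < 1 − a x₂}` of the cube (`δ′ ∈ (0, δ)` rational).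
Transcendence-free and value-free. [cite: KontsevichZagier2001, §1.2 rules (2), (3)] -/
theorem stub_paramLandenLeftovers (a γ : ℝ → ℝ) (δ : ℝ) (hδ : 0 < δ)
    (ha : IsSemialgebraicFunOn ℚ {z : Fin 1 → ℝ | z 0 ∈ Set.Ioo (-δ) (1 + δ)} (fun z => a (z 0)))
    (hγ : IsSemialgebraicFunOn ℚ {z : Fin 1 → ℝ | z 0 ∈ Set.Ioo (-δ) (1 + δ)} (fun z => γ (z 0)))
    (hac : ContDiffOn ℝ 1 a (Set.Ioo (-δ) (1 + δ))) (hγc : ContDiffOn ℝ 1 γ (Set.Ioo (-δ) (1 + δ)))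
    (ha1 : ∀ v ∈ Set.Ioo (-δ) (1 + δ), a v < 1) :
    FibStokesDecomposable 4 (fun x => γ (x 3) *
      ((a (x 3) / (1 - a (x 3) * x 2 * x 0) - a (x 3) / ((1 - a (x 3) * x 2) * (1 - a (x 3) * x 2 + a (x 3) * x 2 * x 0)) +
          (-a (x 3) / (1 - a (x 3) * x 2)) * (-(a (x 3) * x 2) / (1 - a (x 3) * x 2 * x 0))) +
      (1 / 2) * ((-(a (x 3) * x 2) / (1 - a (x 3) * x 2 * x 0)) * (-a (x 3) / (1 - a (x 3) * x 2 * x 1) ^ 2) -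
          (-a (x 3) / (1 - a (x 3) * x 2 * x 0) ^ 2) * (-(a (x 3) * x 2) / (1 - a (x 3) * x 2 * x 1))) +
      ((-a (x 3) / (1 - a (x 3) * x 2)) * (-(a (x 3) * x 2) / (1 - a (x 3) * x 2 * x 1)) -
        (-a (x 3) / (1 - a (x 3) * x 2)) * (-(a (x 3) * x 2) / (1 - a (x 3) * x 2 * x 0))))) := by
  -- a rational margin `δ′ = q ∈ (0, δ)` and the open semialgebraic slab `V = {x | x 3 ∈ (−q, 1+q)}`
  obtain ⟨q, hq0, hqδ⟩ := exists_rat_btwn hδ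
  obtain ⟨V, hV⟩ : ∃ V : Set (Fin 4 → ℝ), V = {x | x 3 ∈ Set.Ioo (-(q : ℝ)) (1 + q)} := ⟨_, rfl⟩
  have hVo : IsOpen V := by rw [hV]; exact isOpen_Ioo.preimage (continuous_apply 3)
  have hVsa : IsSemialgebraic ℚ V := by rw [hV]; exact paramLandenLeft_isSemialgebraic_slab q 3
  have hVI : ∀ x ∈ V, x 3 ∈ Set.Ioo (-δ) (1 + δ) := fun x hx => by
    rw [hV] at hx
    simp only [Set.mem_setOf_eq, Set.mem_Ioo] at hx
    exact ⟨by linarith [hx.1], by linarith [hx.2]⟩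
  -- the readings `A x = a (x 3)`, `G x = γ (x 3)` along the silent coordinate
  obtain ⟨A, hA⟩ : ∃ A : (Fin 4 → ℝ) → ℝ, A = fun x => a (x 3) := ⟨_, rfl⟩
  obtain ⟨G, hG⟩ : ∃ G : (Fin 4 → ℝ) → ℝ, G = fun x => γ (x 3) := ⟨_, rfl⟩
  have hAx : ∀ x, A x = a (x 3) := fun x => congrFun hA x
  have hGx : ∀ x, G x = γ (x 3) := fun x => congrFun hG x
  have sAV : IsSemialgebraicFunOn ℚ V A := by
    rw [hA]
    refine (isSemialgebraicFunOn_comp_coord ha (fun _ : Fin 1 => (3 : Fin 4))).mono (fun x hx => ?_) hVsa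
    simp only [Set.mem_setOf_eq]
    exact hVI x hx
  have sGV : IsSemialgebraicFunOn ℚ V G := by
    rw [hG]
    refine (isSemialgebraicFunOn_comp_coord hγ (fun _ : Fin 1 => (3 : Fin 4))).mono (fun x hx => ?_) hVsa
    simp only [Set.mem_setOf_eq]
    exact hVI x hx
  have hAV : ContDiffOn ℝ 1 A V := by
    rw [hA]; exact hac.comp (contDiff_apply ℝ ℝ (3 : Fin 4)).contDiffOn fun x hx => hVI x hx
  have hGV : ContDiffOn ℝ 1 G V := by
    rw [hG]; exact hγc.comp (contDiff_apply ℝ ℝ (3 : Fin 4)).contDiffOn fun x hx => hVI x hx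
  have hAVc : ContinuousOn A V := hAV.continuousOn
  -- the open semialgebraic neighbourhood `U ⊆ V` of the cube on which all denominators are positive
  obtain ⟨U, hU⟩ : ∃ U : Set (Fin 4 → ℝ), U = {x | x ∈ V ∧ 0 < 1 - A x * x 2 * x 0} ∩
      ({x | x ∈ V ∧ 0 < 1 - A x * x 2 * x 1} ∩ {x | x ∈ V ∧ 0 < 1 - A x * x 2}) := ⟨_, rfl⟩
  have hUV : U ⊆ V := fun x hx => by rw [hU] at hx; exact hx.1.1
  have hUo : IsOpen U := by
    have c0 : ContinuousOn (fun x => 1 - A x * x 2 * x 0) V := by fun_prop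
    have c1 : ContinuousOn (fun x => 1 - A x * x 2 * x 1) V := by fun_prop
    have c2 : ContinuousOn (fun x => 1 - A x * x 2) V := by fun_prop
    rw [hU]
    exact (c0.isOpen_inter_preimage hVo isOpen_Ioi).inter
      ((c1.isOpen_inter_preimage hVo isOpen_Ioi).inter (c2.isOpen_inter_preimage hVo isOpen_Ioi))
  have sxV : ∀ i, IsSemialgebraicFunOn ℚ V (fun x => x i) := fun i => isSemialgebraicFunOn_apply hVsa i
  have s1V : IsSemialgebraicFunOn ℚ V (fun _ => (1:ℝ)) := by
    simpa using isSemialgebraicFunOn_const_natCast hVsa 1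
  have hUsa : IsSemialgebraic ℚ U := by
    have n0 := (((sAV.fun_mul (sxV 2)).fun_mul (sxV 0)).fun_sub s1V).isSemialgebraic_sep_neg
    have n1 := (((sAV.fun_mul (sxV 2)).fun_mul (sxV 1)).fun_sub s1V).isSemialgebraic_sep_neg
    have n2 := ((sAV.fun_mul (sxV 2)).fun_sub s1V).isSemialgebraic_sep_neg
    rw [hU]
    convert n0.inter (n1.inter n2) using 1
    ext x
    simp only [Set.mem_setOf_eq, Set.mem_inter_iff, sub_pos, sub_neg]
  -- the cube lies in `U`
  have hCU : Set.pi Set.univ (fun _ : Fin 4 => Set.Icc (0:ℝ) 1) ⊆ U := by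
    intro x hx
    have hm : ∀ i, x i ∈ Set.Icc (0:ℝ) 1 := fun i => (Set.mem_univ_pi.mp hx) i
    have hxV : x ∈ V := by
      rw [hV]
      simp only [Set.mem_setOf_eq, Set.mem_Ioo]
      exact ⟨by linarith [(hm 3).1], by linarith [(hm 3).2]⟩
    have hA1 : A x < 1 := by rw [hAx]; exact ha1 _ (hVI x hxV)
    have hprod : ∀ i j, 0 < 1 - A x * x i * x j := fun i j => by
      rw [mul_assoc]
      exact landen_denom_pos hA1 (mul_nonneg (hm i).1 (hm j).1) (mul_le_one₀ (hm i).2 (hm j).1 (hm j).2)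
    rw [hU]
    exact ⟨⟨hxV, hprod 2 0⟩, ⟨hxV, hprod 2 1⟩, ⟨hxV, landen_denom_pos hA1 (hm 2).1 (hm 2).2⟩⟩
  -- the denominators do not vanish on `U`; the data are semialgebraic and `C¹` on `U`
  have hD0 : ∀ x ∈ U, 1 - A x * x 2 * x 0 ≠ 0 := fun x hx => by rw [hU] at hx; exact hx.1.2.ne'
  have hD1 : ∀ x ∈ U, 1 - A x * x 2 * x 1 ≠ 0 := fun x hx => by rw [hU] at hx; exact hx.2.1.2.ne'
  have hD2 : ∀ x ∈ U, 1 - A x * x 2 ≠ 0 := fun x hx => by rw [hU] at hx; exact hx.2.2.2.ne'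
  have hD0sq : ∀ x ∈ U, (1 - A x * x 2 * x 0) ^ 2 ≠ 0 := fun x hx => pow_ne_zero 2 (hD0 x hx)
  have hD1sq : ∀ x ∈ U, (1 - A x * x 2 * x 1) ^ 2 ≠ 0 := fun x hx => pow_ne_zero 2 (hD1 x hx)
  have hAU : ContDiffOn ℝ 1 A U := hAV.mono hUV
  have hGU : ContDiffOn ℝ 1 G U := hGV.mono hUV
  have sx : ∀ i, IsSemialgebraicFunOn ℚ U (fun x => x i) := fun i => isSemialgebraicFunOn_apply hUsa i
  have sA : IsSemialgebraicFunOn ℚ U A := sAV.mono hUV hUsa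
  have sG : IsSemialgebraicFunOn ℚ U G := sGV.mono hUV hUsa
  have s1 : IsSemialgebraicFunOn ℚ U (fun _ => (1:ℝ)) := by
    simpa using isSemialgebraicFunOn_const_natCast hUsa 1
  have shalf : IsSemialgebraicFunOn ℚ U (fun _ => (1 / 2 : ℝ)) :=
    (isSemialgebraicFunOn_const_ratCast hUsa (1 / 2)).congr fun _ _ => by norm_num
  have sD0 : IsSemialgebraicFunOn ℚ U (fun x => 1 - A x * x 2 * x 0) :=
    s1.fun_sub ((sA.fun_mul (sx 2)).fun_mul (sx 0))
  have sD1 : IsSemialgebraicFunOn ℚ U (fun x => 1 - A x * x 2 * x 1) :=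
    s1.fun_sub ((sA.fun_mul (sx 2)).fun_mul (sx 1))
  have sD2 : IsSemialgebraicFunOn ℚ U (fun x => 1 - A x * x 2) := s1.fun_sub (sA.fun_mul (sx 2))
  -- (1) `γ(R₁ + R₂ + R₃) = m − m ∘ ρ₀`, `m = γ (a/(1 − a x₂))/(1 − a x₂ x₀)`
  have h1 := landenLeft_sub_comp_reflect_of_contDiffOn U hUo hCU
    (fun x => G x * (A x / (1 - A x * x 2) / (1 - A x * x 2 * x 0)))
    (sG.fun_mul ((sA.div sD2 hD2).div sD0 hD0))
    (by fun_prop (disch := assumption)) 0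
  -- (2) `γA = h − h ∘ σ₀₁`, `h = ½ γ k(x₀,x₂) k_u(x₁,x₂)`
  have h2 := landenLeft_sub_comp_perm_of_contDiffOn U hUo hCU
    (fun x => G x * ((1 / 2) * ((-(A x * x 2) / (1 - A x * x 2 * x 0)) * (-A x / (1 - A x * x 2 * x 1) ^ 2))))
    (sG.fun_mul (shalf.fun_mul (((sA.fun_mul (sx 2)).fun_neg.div sD0 hD0).fun_mul
      (sA.fun_neg.div (sD1.fun_pow 2) hD1sq))))
    (by fun_prop (disch := assumption)) (Equiv.swap 0 1)
  -- (3) `γ(R₃(x₀,x₂) − R₃(x₁,x₂)) = g − g ∘ σ₀₁`, `g = γ (−a/(1 − a x₂)) (−a x₂/(1 − a x₂ x₀))`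
  have h3 := landenLeft_sub_comp_perm_of_contDiffOn U hUo hCU
    (fun x => G x * ((-A x / (1 - A x * x 2)) * (-(A x * x 2) / (1 - A x * x 2 * x 0))))
    (sG.fun_mul ((sA.fun_neg.div sD2 hD2).fun_mul ((sA.fun_mul (sx 2)).fun_neg.div sD0 hD0)))
    (by fun_prop (disch := assumption)) (Equiv.swap 0 1)
  have hsum := fibStokesDecomposable_add 4 _ _ (fibStokesDecomposable_add 4 _ _ h1 h2)
    (fibStokesDecomposable_neg 4 _ h3)
  refine fibStokesDecomposable_congr_off_null 4 _ _ ∅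
    Literature.ModelTheory.ExponentialFields.isSemialgebraic_empty measure_empty (fun x hx _ => ?_) hsum
  -- the pointwise identity on the cube
  have hxU : x ∈ U := hCU hx
  rw [hU] at hxU
  obtain ⟨⟨hxV, d20⟩, ⟨-, d21⟩, ⟨-, d2⟩⟩ := hxU
  rw [hAx] at d20 d21 d2
  have hm : ∀ i, x i ∈ Set.Icc (0:ℝ) 1 := fun i => (Set.mem_univ_pi.mp hx) i
  have hA1 : a (x 3) < 1 := ha1 _ (hVI x hxV)
  have d2r : 0 < 1 - a (x 3) * x 2 + a (x 3) * x 2 * x 0 := by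
    have h0 := hm 0
    have h2' := hm 2
    have := landen_denom_pos hA1 (mul_nonneg h2'.1 (sub_nonneg.2 h0.2))
      (mul_le_one₀ h2'.2 (sub_nonneg.2 h0.2) (by linarith [h0.1]))
    nlinarith
  have h20 : (2 : Fin 4) ≠ 0 := by decide
  have h30 : (3 : Fin 4) ≠ 0 := by decide
  simp only [hAx, hGx, Function.update_self, Function.update_of_ne h20, Function.update_of_ne h30,
    Equiv.swap_apply_left, Equiv.swap_apply_right,
    Equiv.swap_apply_of_ne_of_ne h20 (by decide : (2 : Fin 4) ≠ 1),
    Equiv.swap_apply_of_ne_of_ne h30 (by decide : (3 : Fin 4) ≠ 1)]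
  have e : 1 - a (x 3) * x 2 * (1 - x 0) = 1 - a (x 3) * x 2 + a (x 3) * x 2 * x 0 := by ring
  rw [e]
  field_simp
  ring

end Summit.KontsevichZagierPeriods.KontsevichZagierPeriods.Cruxes.StokesGeneration.FibrewiseStokes

end
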